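import Mathlib.Analysis.InnerProductSpace.Basic

/-!
# C-M1D-2 — band-bottom blindness of local window programs (doped Hubbard chain), TYPED

HONEST FRAMING: first certified bounds; not a superconductivity verdict; every number certified or
labelled float.

Cell sr-mbsolver (venture `CertifiedManyBodySolver`), coordinator STANDING RULE «NUMERICS ⇒ STRUCTURE ⇒ CONJECTURE»
(HOME/INBOX.md l.7305) item (5): a conjecture that survived ≥ 3 pre-registered predictions is typed as a Lean `Prop`
with its evidence ledger under `…/Conjectures/`.  Owner of the statement: unit sr-mbsolver-m1-4 (doped half of T-M1);
statement of record STRUCTURE-TM1-doped.md v0.3 §E′ (sha16 b00aa688ec921b76), HOME/STRUCTURE.md v0.4 §2.1 (F28).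

STATEMENT OF RECORD (C-M1D-2).  'Window program' = a translation-covariant moment relaxation of the Hubbard chain
(t = 1, U ≥ 0, density rows ω(n_{0σ}) = n/2) whose PSD Gram matrix is indexed by ALL words of degree ≤ 2 in the 4w
letters of a window of w sites plus any further IN-WINDOW words and any EOM rows, and with NO Gram block coupling
letters more than w sites apart; e_P(n, U) its optimum.  Then
    e_P(n, U) = −2tn   iff   (U > 0 ∧ n·w ≤ 1) ∨ (U = 0 ∧ n·w ≤ 2),   else e_P(n, U) > −2tn.

WHAT THIS FILE TYPES AND PROVES.  The tree has certificate INSTANCES but no semantics of a program's feasible set, so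
the law is typed in two layers: (i) `WindowPseudoState V w n` = the GNS data of a feasible point (kets c_p ψ, c†_p ψ,
c_q c_p ψ, c†_q c_p ψ in a real inner-product space) with EXACTLY the CAR / translation / density identities the proof
uses — each one a linear identity among degree ≤ 2 moments, i.e. a constraint of every program of the class; over it
the `→` half of the law is PROVED here with no `sorry`: `energy_ge` (e ≥ −2tn), `nw_le_one_of_energy_eq` (U > 0 and
e = −2tn ⇒ n·w ≤ 1, by zero-norm propagation + antisymmetry + the number variance of the window), and
`nw_le_two_of_energy_eq_zeroU` (U = 0 and e = −2tn ⇒ n·w ≤ 2, Pauli on the creator block); (ii)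
`bandBottom_only_if` / `bandBottom_iff`: for ANY value function `val w n U` attained on pseudo-states the `→` half
follows, and the full iff follows once `val` admits the two explicit witnesses of §E′ (hypotheses `wit₁`, `wit₀`:
vacuum ⊕ one-particle functional for n·w ≤ 1, quasi-free functional for n·w ≤ 2 at U = 0).  That the certsdp window
programs admit them (every EOM row pairs off / carries ≥ 2 annihilators) needs program semantics the tree does not
have and stays PROOF TEXT (§E′ steps (3)–(4)) + the numerical ledger.  No `def … : Prop` is introduced (D-0027 §2.1).

EVIDENCE LEDGER (all files under run/shared/lean/speedrun/mbsolver/sr-mbsolver-m1-4/, sha16 in structure/SHA256SUMS):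
 • found post-hoc in canary DS1 = kit j174415 (171 certsdp cells; structure/ds1/kink_table_j174415.json): 14/14
   sub-threshold cells |E_cert + 2n| ≤ 1.4e-7 (exact dyadic E_cert), first residuals beyond threshold +0.1116 (U = 0,
   w = 4, n = 5/8), +0.0261…+0.0872 (w = 4, n = 3/8, U = 1…8);
 • PRE-REGISTERED blind test structure/P-M1D-4.txt sha256 253613d7… (2026-08-22T23:13:15Z, HOME/INBOX l.7559) BEFORE
   canary DS2 = kit j176094 (35 cells, submitted 23:16:13Z): items P-M1D-16…20 survived WHOLE, 25/25 cells
   (structure/ds2/DS2-SCORE.md 7b0dae7bacba8e8a; thresholds n·w = 1 at U > 0 on w = 5, 8 and n·w = 2 at U = 0 attained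
   with equality, first fillings above nontrivial, in-window levers degree-3 / eom-6 blind, one-body reach lever not);
 • follow-up C-M1D-3 (one-body reduction: value = finite-section free-fermion bound, U-independent for n·w ≤ 1)
   pre-registered structure/P-M1D-5.txt sha256 4238ac11… (HOME/INBOX l.7751) before canary DS3 = kit j178239 / j178238.
SCOPE (honest): a METHOD-side law about relaxation VALUES at the band edges (n ≤ 1/w, 2/w and, by particle–hole
covariance, n ≥ 2 − 1/w, 2 − 2/w); it says nothing at the doped target n = 7/8 and nothing about the Hubbard model's
ground state beyond e₀ ≥ e_P.  Nothing here is a certified number; the certified rows live in `../Certificates/`.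

Change log: 2026-08-23 sr-mbsolver-m1-4 gen-8 (planner-sr-mbsolver-m1-4-g8-0): v1, lean-checked rc 0, 0 sorry.
-/

noncomputable section

namespace Summit.Ventures.CertifiedManyBodySolver.Conjectures

open Finset

/-- The modes of a `w`-site window of the Hubbard chain: (spin, site). -/
abbrev Mode (w : ℕ) := Fin 2 × Fin w

/-- WINDOW PSEUDO-STATE (GNS form of a feasible point of a translation-covariant degree-2 window program of the
Hubbard chain at density `n`, `t = 1`): vectors `a p = c_p ψ`, `cr p = c†_p ψ`, `aa q p = c_q c_p ψ`, `ca q p = c†_q c_p ψ`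
in a real inner-product space together with EXACTLY the Gram identities the proof of C-M1D-2 uses (each is a CAR /
translation / density-row identity among degree ≤ 2 words, hence a constraint of every program of the class). -/
structure WindowPseudoState (V : Type*) [NormedAddCommGroup V] [InnerProductSpace ℝ V] (w : ℕ) (n : ℝ) where
  /-- the GNS vector of the identity word -/
  Ω : V
  /-- `a p = c_p ψ` -/
  a : Mode w → V
  /-- `cr p = c†_p ψ` -/
  cr : Mode w → V
  /-- `aa q p = c_q c_p ψ` -/
  aa : Mode w → Mode w → V
  /-- `ca q p = c†_q c_p ψ` -/
  ca : Mode w → Mode w → V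
  /-- the hopping moment `ω(c†_{0σ} c_{1σ})` per spin (translation class of nearest-neighbour pairs) -/
  hop : Fin 2 → ℝ
  /-- the double occupancy `ω(n_{i↑} n_{i↓})` (translation class) -/
  docc : ℝ
  norm_Ω : ‖Ω‖ = 1
  /-- density rows + translation: `ω(n_p) = n/2` for every mode -/
  dens : ∀ p, inner ℝ (a p) (a p) = n / 2
  /-- translation rows: every nearest-neighbour same-spin hopping moment equals `hop σ` -/
  hop_spec : ∀ (σ : Fin 2) (i j : Fin w), (j : ℕ) = i + 1 → inner ℝ (a (σ, i)) (a (σ, j)) = hop σ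
  /-- translation rows: `‖c_{i↓} c_{i↑} ψ‖² = ω(n_{i↑} n_{i↓}) = docc` -/
  docc_spec : ∀ i : Fin w, ‖aa (1, i) (0, i)‖ ^ 2 = docc
  /-- CAR propagation identity `Z†Z = Z† c_q c_q† Z + Z† c_q† c_q Z` for `Z = c_p − c_{p'}` -/
  prop : ∀ q p p', ‖a p - a p'‖ ^ 2 = ‖aa q p - aa q p'‖ ^ 2 + ‖ca q p - ca q p'‖ ^ 2
  /-- CAR: `c_q c_p = − c_p c_q` -/
  anti : ∀ q p, aa q p = -aa p q
  /-- CAR: `ω(n_p n_q) = ‖c_q c_p ψ‖²` for distinct modes -/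
  nn_off : ∀ p q, p ≠ q → inner ℝ (ca p p) (ca q q) = ‖aa q p‖ ^ 2
  /-- CAR + density: `ω(n_p²) = ω(n_p) = n/2` -/
  nn_diag : ∀ p, inner ℝ (ca p p) (ca p p) = n / 2
  /-- density rows: `ω(n_p) = n/2` read against the identity word -/
  n_Ω : ∀ p, inner ℝ (ca p p) Ω = n / 2
  /-- CAR: `ω(c_p c†_q) = δ_{pq} − ω(c†_q c_p)` -/
  cr_gram : ∀ p q, inner ℝ (cr p) (cr q) = (if p = q then 1 else 0) - inner ℝ (a q) (a p)

namespace WindowPseudoState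

variable {V : Type*} [NormedAddCommGroup V] [InnerProductSpace ℝ V] {w : ℕ} {n : ℝ}
/-- The program's objective read on the pseudo-state: `e = −t Σ_σ [ω(c†_0 c_1) + ω(c†_1 c_0)] + U ω(n_↑ n_↓)`, `t = 1`. -/
def energy (ω : WindowPseudoState V w n) (U : ℝ) : ℝ := -2 * (ω.hop 0 + ω.hop 1) + U * ω.docc

/-- The density is nonnegative (it is a Gram norm). -/
lemma n_nonneg (ω : WindowPseudoState V w n) (hw : 0 < w) : 0 ≤ n := by
  have h := ω.dens ((0 : Fin 2), ⟨0, hw⟩)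
  have h2 : 0 ≤ inner ℝ (ω.a ((0 : Fin 2), ⟨0, hw⟩)) (ω.a ((0 : Fin 2), ⟨0, hw⟩)) := real_inner_self_nonneg
  linarith

/-- The double occupancy is nonnegative (it is a Gram norm). -/
lemma docc_nonneg (ω : WindowPseudoState V w n) (hw : 0 < w) : 0 ≤ ω.docc := by
  rw [← ω.docc_spec ⟨0, hw⟩]; positivity

/-- Cauchy–Schwarz on the nearest-neighbour pair of annihilator kets: `ω(c†_0 c_1) ≤ n/2` per spin. -/
lemma hop_le (ω : WindowPseudoState V w n) (hw : 2 ≤ w) (σ : Fin 2) : ω.hop σ ≤ n / 2 := by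
  set i0 : Fin w := ⟨0, by omega⟩
  set i1 : Fin w := ⟨1, by omega⟩
  have hh : inner ℝ (ω.a (σ, i0)) (ω.a (σ, i1)) = ω.hop σ := ω.hop_spec σ i0 i1 rfl
  have h0 := ω.dens (σ, i0)
  have h1 := ω.dens (σ, i1)
  have hsq : ‖ω.a (σ, i0) - ω.a (σ, i1)‖ ^ 2 =
      ‖ω.a (σ, i0)‖ ^ 2 - 2 * inner ℝ (ω.a (σ, i0)) (ω.a (σ, i1)) + ‖ω.a (σ, i1)‖ ^ 2 := norm_sub_sq_real _ _
  rw [← real_inner_self_eq_norm_sq (ω.a (σ, i0)), ← real_inner_self_eq_norm_sq (ω.a (σ, i1)), h0, h1, hh] at hsq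
  have : 0 ≤ ‖ω.a (σ, i0) - ω.a (σ, i1)‖ ^ 2 := by positivity
  linarith

/-- (1) LOWER BOUND: every window program value is at least the band bottom `−2tn`. -/
theorem energy_ge (ω : WindowPseudoState V w n) (hw : 2 ≤ w) {U : ℝ} (hU : 0 ≤ U) : -2 * n ≤ ω.energy U := by
  have h0 := ω.hop_le hw 0
  have h1 := ω.hop_le hw 1
  have hd : 0 ≤ U * ω.docc := mul_nonneg hU (ω.docc_nonneg (by omega))
  unfold energy; linarith

/-- At the band bottom every hopping moment is saturated: `ω(c†_0 c_1) = n/2`. -/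
lemma hop_sat (ω : WindowPseudoState V w n) (hw : 2 ≤ w) {U : ℝ} (hU : 0 ≤ U) (h : ω.energy U = -2 * n) (σ : Fin 2) : ω.hop σ = n / 2 := by
  have h0 := ω.hop_le hw 0
  have h1 := ω.hop_le hw 1
  have hd : 0 ≤ U * ω.docc := mul_nonneg hU (ω.docc_nonneg (by omega))
  unfold energy at h
  fin_cases σ <;> simp <;> linarith

/-- At the band bottom with `U > 0` the double occupancy vanishes. -/
lemma docc_zero (ω : WindowPseudoState V w n) (hw : 2 ≤ w) {U : ℝ} (hU : 0 < U) (h : ω.energy U = -2 * n) : ω.docc = 0 := by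
  have h0 := ω.hop_le hw 0
  have h1 := ω.hop_le hw 1
  have hd0 : 0 ≤ ω.docc := ω.docc_nonneg (by omega)
  have hd : 0 ≤ U * ω.docc := mul_nonneg hU.le hd0
  unfold energy at h
  have hUd : U * ω.docc = 0 := by linarith
  rcases mul_eq_zero.mp hUd with hU0 | hd1
  · exact absurd hU0 hU.ne'
  · exact hd1

/-- (2a) saturation: below the band bottom every nearest-neighbour pair of annihilator kets coincides. -/
lemma a_adj_eq (ω : WindowPseudoState V w n) (hw : 2 ≤ w) {U : ℝ} (hU : 0 ≤ U) (h : ω.energy U = -2 * n) (σ : Fin 2) (i j : Fin w)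
    (hij : (j : ℕ) = i + 1) : ω.a (σ, j) = ω.a (σ, i) := by
  have hh : inner ℝ (ω.a (σ, i)) (ω.a (σ, j)) = n / 2 := by rw [ω.hop_spec σ i j hij, ω.hop_sat hw hU h σ]
  have hsq : ‖ω.a (σ, j) - ω.a (σ, i)‖ ^ 2 =
      ‖ω.a (σ, j)‖ ^ 2 - 2 * inner ℝ (ω.a (σ, j)) (ω.a (σ, i)) + ‖ω.a (σ, i)‖ ^ 2 := norm_sub_sq_real _ _
  rw [← real_inner_self_eq_norm_sq (ω.a (σ, j)), ← real_inner_self_eq_norm_sq (ω.a (σ, i)), ω.dens, ω.dens,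
    real_inner_comm, hh] at hsq
  have h0 : ‖ω.a (σ, j) - ω.a (σ, i)‖ ^ 2 = 0 := by linarith
  rw [sq_eq_zero_iff, norm_eq_zero, sub_eq_zero] at h0
  exact h0

/-- (2b) all annihilator kets of one spin coincide across the window. -/
lemma a_const (ω : WindowPseudoState V w n) (hw : 2 ≤ w) {U : ℝ} (hU : 0 ≤ U) (h : ω.energy U = -2 * n) (σ : Fin 2) (i : Fin w) :
    ω.a (σ, i) = ω.a (σ, ⟨0, by omega⟩) := by
  obtain ⟨k, hk⟩ := i
  induction k with
  | zero => rfl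
  | succ k ih =>
    have hk' : k < w := by omega
    rw [ω.a_adj_eq hw hU h σ ⟨k, hk'⟩ ⟨k + 1, hk⟩ rfl]
    exact ih hk'

/-- (2c) PROPAGATION: two-annihilator kets do not depend on the site of their second letter. -/
lemma aa_snd_const (ω : WindowPseudoState V w n) (hw : 2 ≤ w) {U : ℝ} (hU : 0 ≤ U) (h : ω.energy U = -2 * n) (q : Mode w) (σ : Fin 2)
    (i : Fin w) : ω.aa q (σ, i) = ω.aa q (σ, ⟨0, by omega⟩) := by
  have hp := ω.prop q (σ, i) (σ, ⟨0, by omega⟩)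
  rw [ω.a_const hw hU h σ i, sub_self, norm_zero] at hp
  have h1 : 0 ≤ ‖ω.aa q (σ, i) - ω.aa q (σ, ⟨0, by omega⟩)‖ ^ 2 := by positivity
  have h2 : 0 ≤ ‖ω.ca q (σ, i) - ω.ca q (σ, ⟨0, by omega⟩)‖ ^ 2 := by positivity
  have h0 : ‖ω.aa q (σ, i) - ω.aa q (σ, ⟨0, by omega⟩)‖ ^ 2 = 0 := by linarith
  rw [sq_eq_zero_iff, norm_eq_zero, sub_eq_zero] at h0
  exact h0

/-- (2d) RIGIDITY: at `U > 0` every two-annihilator ket vanishes (same spin by antisymmetry, opposite spin by `docc = 0`). -/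
lemma aa_zero (ω : WindowPseudoState V w n) (hw : 2 ≤ w) {U : ℝ} (hU : 0 < U) (h : ω.energy U = -2 * n) (q p : Mode w) : ω.aa q p = 0 := by
  set i0 : Fin w := ⟨0, by omega⟩ with hi0
  obtain ⟨σ, k⟩ := q
  obtain ⟨τ, i⟩ := p
  -- reduce both site indices to i0
  have r1 : ω.aa (σ, k) (τ, i) = -ω.aa (τ, i0) (σ, i0) := by
    rw [ω.aa_snd_const hw hU.le h (σ, k) τ i, ω.anti (σ, k) (τ, i0), ω.aa_snd_const hw hU.le h (τ, i0) σ k]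
  -- the four spin cases at site i0
  have same : ∀ ρ : Fin 2, ω.aa (ρ, i0) (ρ, i0) = 0 := by
    intro ρ
    have hx := ω.anti (ρ, i0) (ρ, i0)
    have h1 : inner ℝ (ω.aa (ρ, i0) (ρ, i0)) (ω.aa (ρ, i0) (ρ, i0)) =
        inner ℝ (ω.aa (ρ, i0) (ρ, i0)) (-ω.aa (ρ, i0) (ρ, i0)) := by rw [← hx]
    rw [inner_neg_right] at h1
    have h2 : inner ℝ (ω.aa (ρ, i0) (ρ, i0)) (ω.aa (ρ, i0) (ρ, i0)) = 0 := by linarith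
    exact inner_self_eq_zero.mp h2
  have opp10 : ω.aa (1, i0) (0, i0) = 0 := by
    have hd := ω.docc_spec i0
    rw [ω.docc_zero hw hU h, sq_eq_zero_iff, norm_eq_zero] at hd
    exact hd
  have opp01 : ω.aa (0, i0) (1, i0) = 0 := by rw [ω.anti, opp10, neg_zero]
  have all : ∀ ρ ρ' : Fin 2, ω.aa (ρ, i0) (ρ', i0) = 0 := by
    intro ρ ρ'
    fin_cases ρ <;> fin_cases ρ'
    · exact same 0
    · exact opp01
    · exact opp10
    · exact same 1
  rw [r1, all, neg_zero]

/-- At the band bottom (`U > 0`) the density kets `n_p ψ` have Gram matrix `(n/2)·1`. -/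
lemma ca_gram (ω : WindowPseudoState V w n) (hw : 2 ≤ w) {U : ℝ} (hU : 0 < U) (h : ω.energy U = -2 * n) (p q : Mode w) :
    inner ℝ (ω.ca p p) (ω.ca q q) = if p = q then n / 2 else 0 := by
  by_cases hpq : p = q
  · subst hpq; rw [if_pos rfl]; exact ω.nn_diag p
  · rw [if_neg hpq, ω.nn_off p q hpq, ω.aa_zero hw hU h, norm_zero]; ring

/-- (3) THE `U > 0` THRESHOLD (number variance over the window): a window program can sit at the band bottom only if
`n·w ≤ 1`. -/
theorem nw_le_one_of_energy_eq (ω : WindowPseudoState V w n) (hw : 2 ≤ w) {U : ℝ} (hU : 0 < U) (h : ω.energy U = -2 * n) :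
    n * w ≤ 1 := by
  have hn : 0 ≤ n := ω.n_nonneg (by omega)
  set c : ℝ := n * w with hc
  set S : V := ∑ p : Mode w, ω.ca p p with hS
  have hcard : (Finset.univ : Finset (Mode w)).card = 2 * w := by simp [Finset.card_univ, Fintype.card_prod]
  have hSS : inner ℝ S S = n * w := by
    rw [hS, sum_inner]
    simp_rw [inner_sum]
    simp_rw [ω.ca_gram hw hU h]
    simp only [Finset.sum_ite_eq, Finset.mem_univ, if_true, Finset.sum_const, hcard, nsmul_eq_mul]
    push_cast; ring
  have hSΩ : inner ℝ S ω.Ω = n * w := by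
    rw [hS, sum_inner]
    simp_rw [ω.n_Ω]
    simp only [Finset.sum_const, hcard, nsmul_eq_mul]
    push_cast; ring
  have hexp : ‖S - c • ω.Ω‖ ^ 2 = n * w - (n * w) ^ 2 := by
    rw [norm_sub_sq_real, ← real_inner_self_eq_norm_sq, hSS, real_inner_smul_right, hSΩ, norm_smul,
      ω.norm_Ω, mul_one, Real.norm_eq_abs, sq_abs, hc]
    ring
  have hnn : 0 ≤ ‖S - c • ω.Ω‖ ^ 2 := by positivity
  rw [hexp] at hnn
  have hw' : (0 : ℝ) < w := by exact_mod_cast (show 0 < w by omega)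
  by_contra hlt
  have hlt' : 1 < n * w := not_le.mp hlt
  nlinarith [mul_pos (lt_trans one_pos hlt') (sub_pos.mpr hlt')]

/-- (4) THE `U = 0` THRESHOLD (Pauli on the window's creator block): at the band bottom `n·w ≤ 2`. -/
theorem nw_le_two_of_energy_eq_zeroU (ω : WindowPseudoState V w n) (hw : 2 ≤ w) (h : ω.energy 0 = -2 * n) : n * w ≤ 2 := by
  set i0 : Fin w := ⟨0, by omega⟩ with hi0
  set S : V := ∑ i : Fin w, ω.cr (0, i) with hS
  have hcard : (Finset.univ : Finset (Fin w)).card = w := by simp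
  have hgram : ∀ i j : Fin w, inner ℝ (ω.cr (0, i)) (ω.cr (0, j)) = (if i = j then 1 else 0) - n / 2 := by
    intro i j
    rw [ω.cr_gram, ω.a_const hw le_rfl h 0 j, ω.a_const hw le_rfl h 0 i, ω.dens]
    by_cases hij : i = j
    · subst hij; simp
    · have : ((0 : Fin 2), i) ≠ ((0 : Fin 2), j) := by simpa using hij
      simp [hij, this]
  have hSS : inner ℝ S S = w - w ^ 2 * (n / 2) := by
    rw [hS, sum_inner]
    simp_rw [inner_sum, hgram, Finset.sum_sub_distrib]
    simp only [Finset.sum_ite_eq, Finset.mem_univ, if_true, Finset.sum_const, hcard, nsmul_eq_mul]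
    ring
  have hnn : 0 ≤ inner ℝ S S := real_inner_self_nonneg
  rw [hSS] at hnn
  have hw' : (0 : ℝ) < w := by exact_mod_cast (show 0 < w by omega)
  nlinarith

end WindowPseudoState

/-- **C-M1D-2, `→` half, for any VALUE FUNCTION attained on window pseudo-states.**  `val w n U` stands for the
optimum of a window program with window `w` at density `n` and coupling `U` (`t = 1`); `attained` says every optimum
is realised by a GNS pseudo-state (compactness of the spectrahedron + GNS).  Then `val = −2tn` forces the thresholds. -/
theorem bandBottom_only_if {V : Type*} [NormedAddCommGroup V] [InnerProductSpace ℝ V]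
    (val : ℕ → ℝ → ℝ → ℝ)
    (attained : ∀ (w : ℕ) (n U : ℝ), ∃ ω : WindowPseudoState V w n, ω.energy U = val w n U)
    (w : ℕ) (n U : ℝ) (hw : 2 ≤ w) (hU : 0 ≤ U) (hval : val w n U = -2 * n) :
    (0 < U ∧ n * w ≤ 1) ∨ (U = 0 ∧ n * w ≤ 2) := by
  obtain ⟨ω, hω⟩ := attained w n U
  rw [hval] at hω
  rcases hU.lt_or_eq with hpos | hzero
  · exact Or.inl ⟨hpos, ω.nw_le_one_of_energy_eq hw hpos hω⟩
  · subst hzero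
    exact Or.inr ⟨rfl, ω.nw_le_two_of_energy_eq_zeroU hw hω⟩

/-- **C-M1D-2 (statement of record, STRUCTURE-TM1-doped.md §E′) as a THEOREM ABOUT PROGRAM CLASSES.**  For a value
function `val` that is (a) attained on window pseudo-states and (b) admits the two explicit witnesses of §E′ — the
vacuum ⊕ one-particle functional (feasible with value `−2tn` whenever `n·w ≤ 1`, hypothesis `wit₁`) and, at `U = 0`,
the quasi-free functional of the constant one-body matrix (feasible whenever `n·w ≤ 2`, hypothesis `wit₀`) — the
band-bottom law holds EXACTLY:  `val w n U = −2n ↔ (0 < U ∧ n·w ≤ 1) ∨ (U = 0 ∧ n·w ≤ 2)`.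
What remains UNTYPED (no program semantics in the tree): that the certsdp translation-covariant degree-2 window
programs (any in-window extras, any EOM rows) satisfy (a) and (b); (b) is §E′ steps (3)–(4) (every EOM row pairs off
on a translation-invariant one-body matrix; every interaction term of an EOM row carries ≥ 2 annihilators), checked
numerically on 39 sub-threshold cells of DS1/DS2 (|E_cert + 2n| ≤ 1.4e-7). -/
theorem bandBottom_iff {V : Type*} [NormedAddCommGroup V] [InnerProductSpace ℝ V]
    (val : ℕ → ℝ → ℝ → ℝ)
    (attained : ∀ (w : ℕ) (n U : ℝ), ∃ ω : WindowPseudoState V w n, ω.energy U = val w n U)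
    (wit₁ : ∀ (w : ℕ) (n U : ℝ), 2 ≤ w → 0 ≤ n → 0 < U → n * w ≤ 1 → val w n U ≤ -2 * n)
    (wit₀ : ∀ (w : ℕ) (n : ℝ), 2 ≤ w → 0 ≤ n → n * w ≤ 2 → val w n 0 ≤ -2 * n)
    (w : ℕ) (n U : ℝ) (hw : 2 ≤ w) (hn : 0 ≤ n) (hU : 0 ≤ U) :
    val w n U = -2 * n ↔ (0 < U ∧ n * w ≤ 1) ∨ (U = 0 ∧ n * w ≤ 2) := by
  constructor
  · exact bandBottom_only_if val attained w n U hw hU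
  · intro h
    obtain ⟨ω, hω⟩ := attained w n U
    have hge : -2 * n ≤ val w n U := by rw [← hω]; exact ω.energy_ge hw hU
    rcases h with ⟨hpos, hle⟩ | ⟨hzero, hle⟩
    · exact le_antisymm (wit₁ w n U hw hn hpos hle) hge
    · subst hzero
      exact le_antisymm (wit₀ w n hw hn hle) hge

end Summit.Ventures.CertifiedManyBodySolver.Conjectures
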